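import Summits.CriticalPhenomena.Ising3DConformalLimit.Theorems.FKParityRobustnessSourceTrailsMeet
import HarnessLib

/-!
# `SourceTrailsMeet` (stmt-CriticalPhenomena-11255) on the FK ladder: `SourceTrailsMeet → FKFourConnectivity`

Route `FKParityRobustness`, sub-problem `Ising3DConformalLimit`.  Companion to
`FKParityRobustnessSourceTrailsMeet.lean` (the loop-O(1) ⟷ FK-Ising dictionary and
`sourceTrailsMeet_iff_fkMerged : SourceTrailsMeet ↔ (c·φ[a₀↔a₁]φ[a₂↔a₃] ≤ ∫ u_a dφ)`).  Here the
pointwise bound `u_a ≤ 1[all aᵢ joined]` (a `T`-join of `A` inside `ω` that keeps `A` in one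
component joins `A` inside `ω ⊇ F`; and `u_a ≤ 1`) is integrated,

* `integral_tJoinsRatio_le_real_joined` : `∫ u_a dφ ≤ φ[all aᵢ joined]` (clean `tJoins` form),
* `integral_parityRobustness_le_real_joined` : the same with `u_a` written VERBATIM as in the route
  decls (`ParityRobustMerging`, `ParityBound`),

and chained with the merged form of the item:

* `fkFourConnectivity_of_sourceTrailsMeet : SourceTrailsMeet → FKFourConnectivity` (same `c`, `N₀`);

and, in the other direction, Griffiths II in loop dress `Z({a₀,a₁})Z({a₂,a₃}) ≤ Z(∅)Z(A)`
(`loopPairs_le_loopEmpty_mul_zMass`, from FKG for `φ_{p,2}` and `rcMeasure_real_le_zMass_div`) gives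

* `sourceTrailsMeet_of_loopJoinBound` : the loop-side join bound `c·Z(A) ≤ Z(A; all joined)`
  (uniformly in `l`; the sourced loop-O(1) probability that `F` joins `A_l` is `≥ c`) implies the item.

So the item sits between the two cruxes it was filed next to:
`ParityRobustMerging ∧ FKFourConnectivity → SourceTrailsMeet → FKFourConnectivity`
(`sourceTrailsMeet_of_parityRobustMerging_of_fkFourConnectivity`, this file); a refutation of the FK
four-point hyperscaling `FKFourConnectivity` refutes the item, and the item is at least as hard as that
open crux.  Theorem-only file.  References: G. Grimmett, S. Janson, *Random even graphs* (2009), Thm 3.1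
[GrimmettJanson2007]; U. T. Hansen, J. Jiang, F. R. Klausen, arXiv:2506.10765, §2 [HansenJiangKlausen2025].
-/

noncomputable section

open MeasureTheory Finset SimpleGraph
open Literature.Probability.LatticeModels
open Literature.Probability.Percolation
open Summit.CriticalPhenomena.Ising3DConformalLimit.Cruxes.ParityRobustMerging.PlaquetteXorSurgery

namespace Summit.CriticalPhenomena.Ising3DConformalLimit.Theorems

open scoped Classical

section General

variable {V : Type*} [Fintype V] [DecidableEq V] (G : SimpleGraph V) [DecidableRel G.Adj]

/-- **`∫ u_a dφ ≤ φ[all aᵢ joined]`** [folklore]: the fraction of the `T`-joins of `A = {aᵢ}` inside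
`ω` keeping `A` in one component is at most `1`, and it vanishes unless all `aᵢ` are joined in `ω`
(such a `T`-join `F ⊆ ω` joins them already inside `F`).  Free random-cluster measure of a finite
graph, any `p ∈ [0,1]`. -/
theorem integral_tJoinsRatio_le_real_joined {p : ℝ} (hp : p ∈ Set.Icc (0 : ℝ) 1) (a : Fin 4 → V) :
    ∫ ω, (#((tJoins G ω (univ.image a)).filter fun F => JoinsAll a F) : ℝ) /
        (#(tJoins G ω (univ.image a)) : ℝ) ∂(rcMeasure G p 2 ∅) ≤
      (rcMeasure G p 2 ∅).real {ω | ∀ i j, (openGraph ω).Reachable (a i) (a j)} := by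
  rw [integral_rcMeasure G hp two_pos ∅,
    rcMeasure_real_apply G hp two_pos ∅ {ω | ∀ i j, (openGraph ω).Reachable (a i) (a j)}]
  refine Finset.sum_le_sum fun ω _ => ?_
  have hwZ : 0 ≤ rcWeight G p 2 ∅ ω / rcPartitionFunction G p 2 ∅ :=
    div_nonneg (rcWeight_nonneg G hp two_pos.le ∅ ω) (rcPartitionFunction_pos G hp two_pos ∅).le
  split_ifs with hJ
  · refine mul_le_of_le_one_right hwZ (div_le_one_of_le₀ ?_ (Nat.cast_nonneg _))
    exact_mod_cast Finset.card_filter_le _ _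
  · have hempty : (tJoins G (↑ω : Set (Sym2 V)) (univ.image a)).filter (fun F => JoinsAll a F) = ∅ := by
      refine Finset.filter_eq_empty_iff.2 fun F hF hC => hJ ?_
      have hFω : (↑F : Set (Sym2 V)) ⊆ ↑ω := ((mem_tJoins G).1 hF).2.1
      intro i j
      exact (hC i j).mono (fromEdgeSet_mono hFω)
    rw [hempty, Finset.card_empty, Nat.cast_zero, zero_div, mul_zero]

/-- `∫ u_a dφ ≤ φ[all aᵢ joined]` with the parity robustness `u_a` written VERBATIM as in the route
decls `ParityRobustMerging` / `ParityBound` (numerator through the `Finset`-monad coercion,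
`card_filter_bind_pure_coe`), for every finite graph and `p ∈ [0,1]`. [folklore] -/
theorem integral_parityRobustness_le_real_joined (V : Type) [Fintype V] [DecidableEq V]
    (G : SimpleGraph V) [DecidableRel G.Adj] {p : ℝ} (hp : p ∈ Set.Icc (0 : ℝ) 1) (a : Fin 4 → V) :
    (let φ := Literature.Probability.LatticeModels.rcMeasure G p 2 ∅; let sol : Set (Sym2 V) → Finset (Finset (Sym2 V)) := fun ω => G.edgeFinset.powerset.filter (fun F => (↑F : Set (Sym2 V)) ⊆ ω ∧ ∀ v, Odd (F.filter (fun e => v ∈ e)).card ↔ v ∈ Finset.univ.image a); let u : Set (Sym2 V) → ℝ := fun ω => (((sol ω).filter (fun F => ∀ i j, (SimpleGraph.fromEdgeSet (↑F : Set (Sym2 V))).Reachable (a i) (a j))).card : ℝ) / ((sol ω).card : ℝ); ∫ ω, u ω ∂φ ≤ φ.real {ω | ∀ i j, (Literature.Probability.Percolation.openGraph ω).Reachable (a i) (a j)}) := by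
  intro φ sol u
  have hsol : ∀ ω, sol ω = tJoins G ω (univ.image a) := fun ω => rfl
  have hu : ∀ ω, u ω = (#((tJoins G ω (univ.image a)).filter fun F => JoinsAll a F) : ℝ) /
      (#(tJoins G ω (univ.image a)) : ℝ) := by
    intro ω
    simp only [u]
    rw [hsol ω, card_filter_bind_pure_coe _ _ (fun F => JoinsAll a F) (fun F => Iff.rfl)]
  rw [show u = fun ω => (#((tJoins G ω (univ.image a)).filter fun F => JoinsAll a F) : ℝ) /
      (#(tJoins G ω (univ.image a)) : ℝ) from funext hu]
  exact integral_tJoinsRatio_le_real_joined G hp a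

/-- **An event on which a `T`-join of `A` exists has `φ`-mass at most `Z_t(A)/Z_t(∅)`**
[cite: GrimmettJanson2007, Thm 3.1]: if every `ω ⊆ E(G)` in the event `E` carries a `T`-join of
`A = {aᵢ}`, then `φ_{G,p,2}(E) ≤ Z_t(A)/Z_t(∅)` (`t = tanh β`, `p = 1 − e^{−2β}`), because
`1[ω ∈ E] ≤ #𝒯_A(ω)/#𝓔_∅(ω)` (switching count) and the right-hand side integrates to `Z_t(A)/Z_t(∅)`
by the sourced Grimmett–Janson identity. -/
theorem rcMeasure_real_le_zMass_div {β : ℝ} (hβ : 0 ≤ β) (a : Fin 4 → V) (E : Set (BondConfig V))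
    (hE : ∀ ω : Finset (Sym2 V), ω ⊆ G.edgeFinset → (↑ω : BondConfig V) ∈ E →
      (tJoins G (↑ω : Set (Sym2 V)) (univ.image a)).Nonempty) :
    (rcMeasure G (fkIsingParam β) 2 ∅).real E ≤
      zMass G (Real.tanh β) a (fun _ => True) / loopO1PartitionFunction G (Real.tanh β) ∅ := by
  have hp : fkIsingParam β ∈ Set.Icc (0 : ℝ) 1 := fkIsingParam_mem_Icc hβ
  have ht : Real.tanh β = fkIsingParam β / (2 - fkIsingParam β) := tanh_eq_fkIsingParam_div β
  have hZ := rcPartitionFunction_pos G hp two_pos (∅ : Set V)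
  have hGJ := grimmettJanson_identity G (card_evenSubgraphs_mul_two_pow G) hp (univ.image a)
    (fun _ => True)
  simp only [Finset.filter_true] at hGJ
  have hK : (2 : ℝ) ^ Fintype.card V * (1 - fkIsingParam β / 2) ^ #G.edgeFinset ≠ 0 := by
    have : 0 < 1 - fkIsingParam β / 2 := by linarith [hp.2]
    positivity
  have step : ∀ ω ∈ G.edgeFinset.powerset,
      (if (↑ω : BondConfig V) ∈ E then
          rcWeight G (fkIsingParam β) 2 ∅ ω / rcPartitionFunction G (fkIsingParam β) 2 ∅ else 0) ≤
        rcWeight G (fkIsingParam β) 2 ∅ ω *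
            ((#(tJoins G (↑ω : Set (Sym2 V)) (univ.image a)) : ℝ) /
              (#(evenSubgraphs G (↑ω : Set (Sym2 V))) : ℝ)) /
          rcPartitionFunction G (fkIsingParam β) 2 ∅ := by
    intro ω hω
    have hnn : 0 ≤ rcWeight G (fkIsingParam β) 2 ∅ ω *
        ((#(tJoins G (↑ω : Set (Sym2 V)) (univ.image a)) : ℝ) /
          (#(evenSubgraphs G (↑ω : Set (Sym2 V))) : ℝ)) /
        rcPartitionFunction G (fkIsingParam β) 2 ∅ :=
      div_nonneg (mul_nonneg (rcWeight_nonneg G hp two_pos.le ∅ ω) (by positivity)) hZ.le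
    split_ifs with hmem
    · obtain ⟨F₀, hF₀⟩ := hE ω (Finset.mem_powerset.1 hω) hmem
      have hEv : (#(evenSubgraphs G (↑ω : Set (Sym2 V))) : ℝ) ≠ 0 :=
        Nat.cast_ne_zero.2 (Finset.card_pos.2 ⟨∅, empty_mem_evenSubgraphs G _⟩).ne'
      rw [card_tJoins_eq_card_evenSubgraphs G hF₀, div_self hEv, mul_one]
    · exact hnn
  calc (rcMeasure G (fkIsingParam β) 2 ∅).real E
      = ∑ ω ∈ G.edgeFinset.powerset, (if (↑ω : BondConfig V) ∈ E then
          rcWeight G (fkIsingParam β) 2 ∅ ω / rcPartitionFunction G (fkIsingParam β) 2 ∅ else 0) :=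
        rcMeasure_real_apply G hp two_pos ∅ E
    _ ≤ ∑ ω ∈ G.edgeFinset.powerset, rcWeight G (fkIsingParam β) 2 ∅ ω *
            ((#(tJoins G (↑ω : Set (Sym2 V)) (univ.image a)) : ℝ) /
              (#(evenSubgraphs G (↑ω : Set (Sym2 V))) : ℝ)) /
          rcPartitionFunction G (fkIsingParam β) 2 ∅ := Finset.sum_le_sum step
    _ = zMass G (Real.tanh β) a (fun _ => True) / loopO1PartitionFunction G (Real.tanh β) ∅ := by
        rw [← Finset.sum_div, hGJ, rcPartitionFunction_two_eq G hp, loopO1PartitionFunction_eq_sum_tJoins,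
          zMass, Finset.filter_true, ht, mul_div_mul_left _ _ hK]

/-- **Griffiths II in loop dress** [cite: GrimmettJanson2007, Thm 3.1] (with FKG for `φ_{p,2}`,
Fortuin–Kasteleyn–Ginibre 1971): for four distinct vertices and `t = tanh β`, `β ≥ 0`,
`Z_t({a₀,a₁}) · Z_t({a₂,a₃}) ≤ Z_t(∅) · Z_t(A)`.  Proof: divide by `Z_t(∅)²`; the left side is
`φ[a₀↔a₁] φ[a₂↔a₃]` (`rcMeasure_real_openConn_eq`) `≤ φ[a₀↔a₁ ∧ a₂↔a₃]` (FKG,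
`rcMeasure_fkg_holds`) `≤ Z_t(A)/Z_t(∅)` (`rcMeasure_real_le_zMass_div` with the `T`-join of two
pairing paths, `tJoins_nonempty_of_reachable`). -/
theorem loopPairs_le_loopEmpty_mul_zMass {β : ℝ} (hβ : 0 ≤ β) (a : Fin 4 → V)
    (ha : Function.Injective a) :
    (∑ F ∈ tJoins G Set.univ {a 0, a 1}, Real.tanh β ^ #F) *
        (∑ F ∈ tJoins G Set.univ {a 2, a 3}, Real.tanh β ^ #F) ≤
      loopO1PartitionFunction G (Real.tanh β) ∅ * zMass G (Real.tanh β) a (fun _ => True) := by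
  have hp : fkIsingParam β ∈ Set.Icc (0 : ℝ) 1 := fkIsingParam_mem_Icc hβ
  have hZ0 : 0 < loopO1PartitionFunction G (Real.tanh β) ∅ := loopO1PartitionFunction_tanh_empty_pos G hβ
  have h01 : a 0 ≠ a 1 := ha.ne (by decide)
  have h23 : a 2 ≠ a 3 := ha.ne (by decide)
  -- FKG for the two increasing connection events, then the `T`-join bound on the intersection
  have hfkg := rcMeasure_fkg_holds G hp one_le_two (∅ : Set V)
    (isUpperSet_openConn (a 0) (a 1)) (isUpperSet_openConn (a 2) (a 3))
  have hE : ∀ ω : Finset (Sym2 V), ω ⊆ G.edgeFinset →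
      (↑ω : BondConfig V) ∈ openConn (a 0) (a 1) ∩ openConn (a 2) (a 3) →
        (tJoins G (↑ω : Set (Sym2 V)) (univ.image a)).Nonempty := fun ω hω hmem =>
    tJoins_nonempty_of_reachable G ω hω a ha hmem.1 hmem.2
  have hle := hfkg.trans (rcMeasure_real_le_zMass_div G hβ a _ hE)
  rw [rcMeasure_real_openConn_eq G hβ h01, rcMeasure_real_openConn_eq G hβ h23] at hle
  have hZ0' : loopO1PartitionFunction G (Real.tanh β) ∅ ≠ 0 := hZ0.ne'
  calc (∑ F ∈ tJoins G Set.univ {a 0, a 1}, Real.tanh β ^ #F) *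
        (∑ F ∈ tJoins G Set.univ {a 2, a 3}, Real.tanh β ^ #F)
      = loopO1PartitionFunction G (Real.tanh β) ∅ * loopO1PartitionFunction G (Real.tanh β) ∅ *
          ((∑ F ∈ tJoins G Set.univ {a 0, a 1}, Real.tanh β ^ #F) /
              loopO1PartitionFunction G (Real.tanh β) ∅ *
            ((∑ F ∈ tJoins G Set.univ {a 2, a 3}, Real.tanh β ^ #F) /
              loopO1PartitionFunction G (Real.tanh β) ∅)) := by
        field_simp
    _ ≤ loopO1PartitionFunction G (Real.tanh β) ∅ * loopO1PartitionFunction G (Real.tanh β) ∅ *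
          (zMass G (Real.tanh β) a (fun _ => True) / loopO1PartitionFunction G (Real.tanh β) ∅) :=
        mul_le_mul_of_nonneg_left hle (mul_pos hZ0 hZ0).le
    _ = loopO1PartitionFunction G (Real.tanh β) ∅ * zMass G (Real.tanh β) a (fun _ => True) := by
        field_simp

end General

section Box

open Summit.CriticalPhenomena.Ising3DConformalLimit.Theses.FKParityRobustness

/-- **The item implies FK four-point hyperscaling**: `SourceTrailsMeet → FKFourConnectivity`, with
the same constant and the same `N₀(l)` — `c·φ[a₀↔a₁]φ[a₂↔a₃] ≤ ∫ u_a dφ`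
(`sourceTrailsMeet_iff_fkMerged`) and `∫ u_a dφ ≤ φ[all joined]`
(`integral_parityRobustness_le_real_joined`). [cite: GrimmettJanson2007, Thm 3.1] -/
theorem fkFourConnectivity_of_sourceTrailsMeet : SourceTrailsMeet → FKFourConnectivity := by
  intro hS
  rw [sourceTrailsMeet_iff_fkMerged] at hS
  unfold FKFourConnectivity
  intro tetra
  obtain ⟨c, hc, hS⟩ := hS
  refine ⟨c, hc, fun l hl => ?_⟩
  obtain ⟨N₀, hS⟩ := hS l hl
  refine ⟨N₀, fun N hN a ha => ?_⟩
  have hp : fkIsingParam (criticalBeta 3) ∈ Set.Icc (0 : ℝ) 1 :=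
    fkIsingParam_mem_Icc (criticalBeta_nonneg 3)
  have hS := hS N hN a ha
  intro G φ
  have key : ∀ I : ℝ, c * φ.real (openConn (a 0) (a 1)) * φ.real (openConn (a 2) (a 3)) ≤ I →
      I ≤ φ.real {ω | ∀ i j, (openGraph ω).Reachable (a i) (a j)} →
      c * φ.real (openConn (a 0) (a 1)) * φ.real (openConn (a 2) (a 3)) ≤
        φ.real {ω | ∀ i j, (openGraph ω).Reachable (a i) (a j)} := fun I h1 h2 => h1.trans h2
  exact key _ hS (integral_parityRobustness_le_real_joined _ G hp a)

/-- **The loop-side join bound implies the item**: if the sourced loop-O(1) configuration with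
sources `A_l` keeps all four sources in one component with probability `≥ c` uniformly
(`c · Z_t(A) ≤ Z_t(A; all joined)` in every large box — the loop-side form of the crux line
`plaquette-xor-surgery`, cf. `stub_fkLoopTransfer`), then `SourceTrailsMeet` holds with the same
`c`: `c·Z({a₀,a₁})Z({a₂,a₃}) ≤ c·Z(∅)Z(A) ≤ Z(∅)Z(A; all joined)` by Griffiths II in loop dress
(`loopPairs_le_loopEmpty_mul_zMass`). [cite: GrimmettJanson2007, Thm 3.1] -/
theorem sourceTrailsMeet_of_loopJoinBound :
    (let tetra : Fin 4 → Literature.Probability.LatticeModels.Site 3 := ![![-1, -1, -1], ![1, 1, -1], ![1, -1, 1], ![-1, 1, 1]]; ∃ c : ℝ, 0 < c ∧ ∀ l : ℕ, 1 ≤ l → ∃ N₀ : ℕ, ∀ N : ℕ, N₀ ≤ N → ∀ a : Fin 4 → ↥(Literature.Probability.LatticeModels.box 3 N), (∀ i, ((a i : Literature.Probability.LatticeModels.Site 3)) = (l : ℤ) • tetra i) → c * zMass ((Literature.Probability.LatticeModels.zdGraph 3).comap (Subtype.val : ↥(Literature.Probability.LatticeModels.box 3 N) → Literature.Probability.LatticeModels.Site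 3)) (Real.tanh (Literature.Probability.LatticeModels.criticalBeta 3)) a (fun _ => True) ≤ zMass ((Literature.Probability.LatticeModels.zdGraph 3).comap (Subtype.val : ↥(Literature.Probability.LatticeModels.box 3 N) → Literature.Probability.LatticeModels.Site 3)) (Real.tanh (Literature.Probability.LatticeModels.criticalBeta 3)) a (fun F => JoinsAll a F)) →
    SourceTrailsMeet := by
  intro h
  unfold SourceTrailsMeet
  intro tetra
  obtain ⟨c, hc, h⟩ := h
  refine ⟨c, hc, fun l hl => ?_⟩
  obtain ⟨N₀, h⟩ := h l hl
  refine ⟨N₀, fun N hN a ha => ?_⟩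
  have hainj : Function.Injective a := tetra_injective hl a ha
  have hβ : 0 ≤ criticalBeta 3 := criticalBeta_nonneg 3
  have hZ0 : 0 < loopO1PartitionFunction (boxGraph N) tc ∅ := loopO1PartitionFunction_tanh_empty_pos _ hβ
  have h := h N hN a ha
  intro E t Z
  have hZ : ∀ (S : Finset ↥(box 3 N)) (P : Finset (Sym2 ↥(box 3 N)) → Prop),
      Z S P = ∑ F ∈ (tJoins (boxGraph N) Set.univ S).filter (fun F => P F), tc ^ #F := by
    intro S P
    simp only [Z, E, t]
    exact sum_powerset_filter_parity_eq _ _ S P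
  rw [hZ, hZ, hZ, hZ, Finset.filter_true, Finset.filter_true, Finset.filter_true,
    ← loopO1PartitionFunction_eq_sum_tJoins (boxGraph N) tc ∅]
  have hpairs := loopPairs_le_loopEmpty_mul_zMass (boxGraph N) hβ a hainj
  have hmain : c * (∑ F ∈ tJoins (boxGraph N) Set.univ {a 0, a 1}, tc ^ #F) *
      (∑ F ∈ tJoins (boxGraph N) Set.univ {a 2, a 3}, tc ^ #F) ≤
      loopO1PartitionFunction (boxGraph N) tc ∅ * zMass (boxGraph N) tc a (fun F => JoinsAll a F) :=
    calc c * (∑ F ∈ tJoins (boxGraph N) Set.univ {a 0, a 1}, tc ^ #F) *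
          (∑ F ∈ tJoins (boxGraph N) Set.univ {a 2, a 3}, tc ^ #F)
        = c * ((∑ F ∈ tJoins (boxGraph N) Set.univ {a 0, a 1}, tc ^ #F) *
            (∑ F ∈ tJoins (boxGraph N) Set.univ {a 2, a 3}, tc ^ #F)) := by ring
      _ ≤ c * (loopO1PartitionFunction (boxGraph N) tc ∅ * zMass (boxGraph N) tc a (fun _ => True)) :=
          mul_le_mul_of_nonneg_left hpairs hc.le
      _ = loopO1PartitionFunction (boxGraph N) tc ∅ * (c * zMass (boxGraph N) tc a (fun _ => True)) := by
          ring
      _ ≤ loopO1PartitionFunction (boxGraph N) tc ∅ * zMass (boxGraph N) tc a (fun F => JoinsAll a F) :=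
          mul_le_mul_of_nonneg_left h hZ0.le
  refine hmain.trans_eq ?_
  unfold zMass
  congr 1

end Box

end Summit.CriticalPhenomena.Ising3DConformalLimit.Theorems

end
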